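import Literature.IUT.LogVolume.TensorPacketTransport
import Literature.IUT.LogVolume.TensorPacketHaar
import Literature.IUT.LogVolume.HaarTransport
import Literature.IUT.LogThetaLattice.PacketLogVolumes
import HarnessLib

/-!
# Tensor packets: transport along FACTORWISE field isomorphisms `⊗_i φ_i : ⊗ k_i ⥲ ⊗ k'_i` — the intrinsic
# log-volume `μ^log` is compatible ([IUTchIII] Prop. 3.9 (ii) / Prop. 3.2 (i) at the REAL tensor packet)

S. Mochizuki, *Inter-universal Teichmüller theory III*, kurims manuscript (May 2020), Prop. 3.9 (ii)
"(Mono-analytic Compatibility)", p. 116 [claim: Mochizuki2012, status: disputed]: the log-volumes on the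
mono-analytic tensor packets "may be constructed via a functorial algorithm from the `𝒟^⊢`-prime-strips" and
are "compatible with the log-volumes obtained in (i), relative to the natural poly-isomorphisms of Proposition
3.2, (i)" — where Prop. 3.2 (i) (p. 98) induces the packet isomorphisms from FACTORWISE isomorphisms
`log(^α𝒟^⊢_v) ⥲ log(^α𝓕_v)` by "functoriality of ⊗"; [IUTchIV] Prop. 1.4 (i), kurims p. 13: the log-volume
`μ^log` on `⊗_{ℚ_p} k_i`, "normalized so that `μ^log((R_E)^∼) = 0`".

Campaign S realises the one-place tensor packet `V = ⊗_{ℚ_p} k_i` as `PacketAlgebra p k` (abc-iut-S1,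
`TensorPacketRing.lean`) with its intrinsic normalised Haar log-volume `tensorLogVolume p k` (abc-iut-S7,
`TensorPacketHaar.lean`), and proves its invariance under the (Ind1) factor PERMUTATIONS `⊗ k_{σ(i)} ⥲ ⊗ k_i`
(`TensorPacketTransport.lean`, abc-iut-S8) and the (Ind2) lattice automorphisms. THIS FILE adds the
two-packet transport that the census of [IUTchIII] Prop. 3.9 (plan/L6/SUBDAG-IUTchIII-Prop-39.md, row
Prop-39.ii.r13, residual R-iii-tensor; seat abc-iut-w5-d178) found missing: for a family of ISOMETRIC
`ℚ_p`-algebra isomorphisms `φ_i : k_i ⥲ k'_i` (the isomorphism class of the local field is all a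
`𝒟^⊢`-prime-strip remembers),

* `factorAlgEquiv φ : ⊗ k_i ≃ₐ[ℚ_p] ⊗ k'_i` — Mathlib's `PiTensorProduct.congr` upgraded to an ALGEBRA
  isomorphism (`factorAlgEquiv_purePacket`: `⊗ x_i ↦ ⊗ φ_i(x_i)`), and `factorEquiv φ` the same map as a
  bicontinuous additive isomorphism for the module topologies;
* **it maps `R_I` onto `R'_I`** (`image_integerPacket_factor`: generators `⊗ x_i`, `‖x_i‖ ≤ 1`, correspond
  because the `φ_i` are isometries) and **`(R_I)^∼` onto `(R'_I)^∼`** (`image_normalizedPacket_factor`: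
  `ℤ_p`-integrality is preserved both ways, abc-iut-S5's `mem_normalizedPacket_iff_isIntegral`);
* hence, by Haar uniqueness (campaign-S `IntegralStructure.logVolume_image_equiv`, abc-iut-c312-d1) and
  `dim_{ℚ_p} ⊗ k_i = dim_{ℚ_p} ⊗ k'_i`, **`μ^log(Φ(A)) = μ^log(A)` for EVERY subset `A`**
  (`tensorLogVolume_image_factor`) — i.e. `μ^log` depends on the packet only through the isometry classes
  of its factors ("functorial algorithm from the `𝒟^⊢`-prime-strips");
* the [IUTchIII] Prop. 3.9 (ii) junction BY NAME: abc-iut-L6-t4's `Prop39ii_monoAnalyticCompat`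
  (`PacketLogVolumes.lean`, p404053) HOLDS for the poly-isomorphism `{⊗ φ_i | φ ∈ P}` induced by any set `P`
  of families of isometric factor isomorphisms, with `μ^log` on both sides
  (`prop39ii_monoAnalyticCompat_tensorPacket`).

Everything is a theorem of Mathlib's `PiTensorProduct` / Haar measure in campaign-S vocabulary; nothing here
bears on the disputed [IUTchIII] Cor. 3.12 or takes a side; typed ≠ endorsed.
[cite: Mochizuki2012, IUTchIV Prop. 1.4 (i) p. 13] [cite: DupuyHilado2025, §4.7]
-/

noncomputable section

open MeasureTheory Set Metric Module
open scoped TensorProduct NormedField Pointwise ENNReal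

namespace Literature.IUT.LogVolume

variable (p : ℕ) [Fact p.Prime]
variable {I : Type} [Fintype I] [DecidableEq I]
variable (k : I → Type) [∀ i, NontriviallyNormedField (k i)] [∀ i, NormedAlgebra ℚ_[p] (k i)]
  [∀ i, IsUltrametricDist (k i)] [∀ i, ProperSpace (k i)]
variable (k' : I → Type) [∀ i, NontriviallyNormedField (k' i)] [∀ i, NormedAlgebra ℚ_[p] (k' i)]
  [∀ i, IsUltrametricDist (k' i)] [∀ i, ProperSpace (k' i)]
variable (φ : ∀ i, k i ≃ₐ[ℚ_[p]] k' i)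

/-! ## The factorwise isomorphism `⊗ φ_i` as an algebra isomorphism -/

section Algebra

omit [Fintype I] [DecidableEq I] [∀ i, IsUltrametricDist (k i)] [∀ i, ProperSpace (k i)]
  [∀ i, IsUltrametricDist (k' i)] [∀ i, ProperSpace (k' i)]

/-- `⊗_i φ_i : ⊗ k_i ≃ ⊗ k'_i` as a LINEAR isomorphism (Mathlib `PiTensorProduct.congr`; [IUTchIII] Prop. 3.2 (i)
"functoriality of ⊗"). [claim: Mochizuki2012, status: disputed] -/
def factorLinearEquiv : PacketAlgebra p k ≃ₗ[ℚ_[p]] PacketAlgebra p k' :=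
  PiTensorProduct.congr fun i => (φ i).toLinearEquiv

/-- **On pure tensors**: `(⊗ φ_i)(⊗ x_i) = ⊗ φ_i(x_i)`. [claim: Mochizuki2012, status: disputed] -/
theorem factorLinearEquiv_tprod (x : Π i, k i) :
    factorLinearEquiv p k k' φ (PiTensorProduct.tprod ℚ_[p] x) =
      PiTensorProduct.tprod ℚ_[p] (fun i => φ i (x i)) :=
  PiTensorProduct.congr_tprod _ x

/-- `⊗ φ_i` is multiplicative. [claim: Mochizuki2012, status: disputed] -/
theorem factorLinearEquiv_map_mul (x y : PacketAlgebra p k) :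
    factorLinearEquiv p k k' φ (x * y) = factorLinearEquiv p k k' φ x * factorLinearEquiv p k k' φ y := by
  induction x using PiTensorProduct.induction_on with
  | smul_tprod r f =>
    induction y using PiTensorProduct.induction_on with
    | smul_tprod r' g =>
      rw [PiTensorProduct.smul_tprod_mul_smul_tprod, map_smul, map_smul, map_smul,
        factorLinearEquiv_tprod, factorLinearEquiv_tprod, factorLinearEquiv_tprod,
        PiTensorProduct.smul_tprod_mul_smul_tprod]
      congr 1
      exact congrArg (PiTensorProduct.tprod ℚ_[p]) (funext fun i => map_mul (φ i) (f i) (g i))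
    | add a b ha hb => rw [mul_add, map_add, ha, hb, map_add, mul_add]
  | add a b ha hb => rw [add_mul, map_add, ha, hb, map_add, add_mul]

/-- `(⊗ φ_i)(1) = 1`. [claim: Mochizuki2012, status: disputed] -/
theorem factorLinearEquiv_map_one : factorLinearEquiv p k k' φ 1 = 1 := by
  rw [PiTensorProduct.one_def, factorLinearEquiv_tprod, PiTensorProduct.one_def]
  exact congrArg (PiTensorProduct.tprod ℚ_[p]) (funext fun i => map_one (φ i))

/-- **The factorwise isomorphism `⊗ φ_i : ⊗ k_i ≃ₐ[ℚ_p] ⊗ k'_i`** as a `ℚ_p`-ALGEBRA isomorphism.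
[claim: Mochizuki2012, status: disputed] -/
def factorAlgEquiv : PacketAlgebra p k ≃ₐ[ℚ_[p]] PacketAlgebra p k' :=
  AlgEquiv.ofLinearEquiv (factorLinearEquiv p k k' φ) (factorLinearEquiv_map_one p k k' φ)
    (factorLinearEquiv_map_mul p k k' φ)

/-- `factorAlgEquiv` acts as `factorLinearEquiv`. [claim: Mochizuki2012, status: disputed] -/
@[simp] theorem factorAlgEquiv_apply (x : PacketAlgebra p k) :
    factorAlgEquiv p k k' φ x = factorLinearEquiv p k k' φ x := rfl

/-- On pure tensors (`purePacket` form): `(⊗ φ_i)(⊗ x_i) = ⊗ φ_i(x_i)`. [claim: Mochizuki2012, status: disputed] -/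
theorem factorAlgEquiv_purePacket (x : Π i, k i) :
    factorAlgEquiv p k k' φ (purePacket p k x) = purePacket p k' (fun i => φ i (x i)) :=
  factorLinearEquiv_tprod p k k' φ x

end Algebra

/-! ## `⊗ φ_i` maps `R_I` onto `R'_I` and `(R_I)^∼` onto `(R'_I)^∼` (isometric factors) -/

section Images

omit [Fintype I] [DecidableEq I] [∀ i, IsUltrametricDist (k i)] [∀ i, ProperSpace (k i)]
  [∀ i, IsUltrametricDist (k' i)] [∀ i, ProperSpace (k' i)] in
/-- The generating pure tensors of `R_I` (`⊗ x_i`, `‖x_i‖ ≤ 1`) correspond under `⊗ φ_i` when the `φ_i` are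
isometries. [claim: Mochizuki2012, status: disputed] -/
theorem image_integerPacket_generators (hφ : ∀ i (x : k i), ‖φ i x‖ = ‖x‖) :
    factorAlgEquiv p k k' φ '' {t | ∃ x : Π i, k i, (∀ i, ‖x i‖ ≤ 1) ∧ t = purePacket p k x} =
      {t | ∃ y : Π i, k' i, (∀ i, ‖y i‖ ≤ 1) ∧ t = purePacket p k' y} := by
  ext t
  constructor
  · rintro ⟨_, ⟨x, hx, rfl⟩, rfl⟩
    exact ⟨fun i => φ i (x i), fun i => by rw [hφ]; exact hx i, factorAlgEquiv_purePacket p k k' φ x⟩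
  · rintro ⟨y, hy, rfl⟩
    refine ⟨purePacket p k (fun i => (φ i).symm (y i)), ⟨_, fun i => ?_, rfl⟩, ?_⟩
    · rw [← hφ i, AlgEquiv.apply_symm_apply]
      exact hy i
    · rw [factorAlgEquiv_purePacket]
      exact congrArg (purePacket p k') (funext fun i => (φ i).apply_symm_apply (y i))

omit [Fintype I] [DecidableEq I] [∀ i, IsUltrametricDist (k i)] [∀ i, ProperSpace (k i)]
  [∀ i, IsUltrametricDist (k' i)] [∀ i, ProperSpace (k' i)] in
/-- **`(⊗ φ_i)(R_I) = R'_I`** for isometric `φ_i` (a ring isomorphism maps the subring generated by a set onto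
the subring generated by its image). [claim: Mochizuki2012, status: disputed] -/
theorem image_integerPacket_factor (hφ : ∀ i (x : k i), ‖φ i x‖ = ‖x‖) :
    factorAlgEquiv p k k' φ '' (integerPacket p k : Set (PacketAlgebra p k)) = integerPacket p k' := by
  have h := RingHom.map_closure
    ((factorAlgEquiv p k k' φ : PacketAlgebra p k ≃ₐ[ℚ_[p]] PacketAlgebra p k') :
      PacketAlgebra p k →+* PacketAlgebra p k')
    {t | ∃ x : Π i, k i, (∀ i, ‖x i‖ ≤ 1) ∧ t = purePacket p k x}
  have h' := congrArg (fun H : Subring (PacketAlgebra p k') => (H : Set (PacketAlgebra p k'))) h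
  simp only [Subring.coe_map] at h'
  rw [integerPacket, integerPacket, ← image_integerPacket_generators p k k' φ hφ]
  exact h'

variable [Nonempty I]

omit [DecidableEq I] in
/-- **`(⊗ φ_i)((R_I)^∼) = (R'_I)^∼`**: a `ℚ_p`-algebra isomorphism preserves `ℤ_p`-integrality both ways
(abc-iut-S5's characterisation `(R_I)^∼ = {ℤ_p-integral elements}`). [claim: Mochizuki2012, status: disputed] -/
theorem image_normalizedPacket_factor :
    factorAlgEquiv p k k' φ '' (normalizedPacket p k : Set (PacketAlgebra p k)) = normalizedPacket p k' := by
  ext y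
  constructor
  · rintro ⟨x, hx, rfl⟩
    rw [SetLike.mem_coe, mem_normalizedPacket_iff_isIntegral]
    rw [SetLike.mem_coe, mem_normalizedPacket_iff_isIntegral] at hx
    exact hx.map (factorAlgEquiv p k k' φ : PacketAlgebra p k →ₐ[ℚ_[p]] PacketAlgebra p k')
  · intro hy
    refine ⟨(factorAlgEquiv p k k' φ).symm y, ?_, (factorAlgEquiv p k k' φ).apply_symm_apply y⟩
    rw [SetLike.mem_coe, mem_normalizedPacket_iff_isIntegral]
    rw [SetLike.mem_coe, mem_normalizedPacket_iff_isIntegral] at hy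
    exact hy.map ((factorAlgEquiv p k k' φ).symm : PacketAlgebra p k' →ₐ[ℚ_[p]] PacketAlgebra p k)

end Images

/-! ## `⊗ φ_i` as a bicontinuous isomorphism; `μ^log` is transported -/

section Volume

omit [Fintype I] [DecidableEq I] [∀ i, IsUltrametricDist (k i)] [∀ i, ProperSpace (k i)]
  [∀ i, IsUltrametricDist (k' i)] [∀ i, ProperSpace (k' i)] in
include φ in
/-- `dim_{ℚ_p} ⊗ k_i = dim_{ℚ_p} ⊗ k'_i` (isomorphic `ℚ_p`-vector spaces). [claim: Mochizuki2012, status: disputed] -/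
theorem finrank_factor_eq : finrank ℚ_[p] (PacketAlgebra p k) = finrank ℚ_[p] (PacketAlgebra p k') :=
  (factorAlgEquiv p k k' φ).toLinearEquiv.finrank_eq

/-- **`⊗ φ_i` is a homeomorphism** (as an additive isomorphism): both packets carry the module topology, for
which `ℚ_p`-linear maps are continuous. [claim: Mochizuki2012, status: disputed] -/
def factorEquiv : PacketAlgebra p k ≃ₜ+ PacketAlgebra p k' :=
  haveI : ContinuousAdd (PacketAlgebra p k) := IsModuleTopology.toContinuousAdd ℚ_[p] _
  haveI : ContinuousAdd (PacketAlgebra p k') := IsModuleTopology.toContinuousAdd ℚ_[p] _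
  { (factorAlgEquiv p k k' φ).toLinearEquiv.toAddEquiv with
    continuous_toFun :=
      IsModuleTopology.continuous_of_linearMap (factorAlgEquiv p k k' φ).toLinearEquiv.toLinearMap
    continuous_invFun :=
      IsModuleTopology.continuous_of_linearMap (factorAlgEquiv p k k' φ).toLinearEquiv.symm.toLinearMap }

omit [Fintype I] [DecidableEq I] [∀ i, IsUltrametricDist (k i)] [∀ i, ProperSpace (k i)]
  [∀ i, IsUltrametricDist (k' i)] [∀ i, ProperSpace (k' i)] in
/-- Unfolding `factorEquiv`. [claim: Mochizuki2012, status: disputed] -/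
@[simp] theorem factorEquiv_apply (x : PacketAlgebra p k) : factorEquiv p k k' φ x = factorAlgEquiv p k k' φ x :=
  rfl

omit [Fintype I] [DecidableEq I] [∀ i, IsUltrametricDist (k i)] [∀ i, ProperSpace (k i)]
  [∀ i, IsUltrametricDist (k' i)] [∀ i, ProperSpace (k' i)] in
/-- `factorEquiv` and `factorAlgEquiv` have the same image sets. [claim: Mochizuki2012, status: disputed] -/
theorem image_factorEquiv (A : Set (PacketAlgebra p k)) :
    factorEquiv p k k' φ '' A = factorAlgEquiv p k k' φ '' A := rfl

variable [Nonempty I]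

/-- **Haar transport**: for isometric `φ_i`, `μ_{R'_I}((⊗ φ_i)(A)) = μ_{R_I}(A)` for EVERY `A` — the normalised
Haar measures of the two packets (normalised at `R_I`, `R'_I`) correspond under `⊗ φ_i`, which carries `R_I`
onto `R'_I`. [claim: Mochizuki2012, status: disputed] -/
theorem haar_image_factor (hφ : ∀ i (x : k i), ‖φ i x‖ = ‖x‖) (A : Set (PacketAlgebra p k)) :
    (integerStructure p k').haar (factorAlgEquiv p k k' φ '' A) = (integerStructure p k).haar A := by
  rw [← image_factorEquiv]
  exact (integerStructure p k).haar_image_equiv (integerStructure p k') (factorEquiv p k k' φ)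
    (by rw [image_factorEquiv, coe_integerStructure, coe_integerStructure,
      image_integerPacket_factor p k k' φ hφ]) A

/-- **[IUTchIV] Prop. 1.4 (i) / [IUTchIII] Prop. 3.9 (ii) at the REAL tensor packet: `μ^log` is transported
along factorwise isometric field isomorphisms** — `μ^log_{⊗ k'}((⊗ φ_i)(A)) = μ^log_{⊗ k}(A)` for EVERY subset
`A ⊆ ⊗ k_i`: same normalised Haar measure (`haar_image_factor`), same shift (`(R_I)^∼ ↦ (R'_I)^∼`), same
dimension. So `μ^log` depends on the packet only through the isometry classes of its factors — the
"functorial algorithm from the `𝒟^⊢`-prime-strips" of Prop. 3.9 (ii). [claim: Mochizuki2012, status: disputed] -/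
theorem tensorLogVolume_image_factor (hφ : ∀ i (x : k i), ‖φ i x‖ = ‖x‖) (A : Set (PacketAlgebra p k)) :
    tensorLogVolume p k' (factorAlgEquiv p k k' φ '' A) = tensorLogVolume p k A := by
  unfold tensorLogVolume IntegralStructure.normalizedLogVolume IntegralStructure.logVolume
  rw [haar_image_factor p k k' φ hφ A, ← image_normalizedPacket_factor p k k' φ,
    haar_image_factor p k k' φ hφ, finrank_factor_eq p k k' φ]

/-- The inverse direction: `μ^log_{⊗ k}((⊗ φ_i)⁻¹(B)) = μ^log_{⊗ k'}(B)`. [claim: Mochizuki2012, status: disputed] -/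
theorem tensorLogVolume_preimage_factor (hφ : ∀ i (x : k i), ‖φ i x‖ = ‖x‖) (B : Set (PacketAlgebra p k')) :
    tensorLogVolume p k (factorAlgEquiv p k k' φ ⁻¹' B) = tensorLogVolume p k' B := by
  rw [← tensorLogVolume_image_factor p k k' φ hφ, Set.image_preimage_eq _ (factorAlgEquiv p k k' φ).surjective]

/-- **[IUTchIII] Prop. 3.9 (ii) BY NAME at the REAL tensor packet.** For any set `P` of families of isometric
factor isomorphisms `k_i ⥲ k'_i` (the poly-isomorphism of Prop. 3.2 (i) induced, factor by factor, by the
poly-isomorphisms of log-shells), abc-iut-L6-t4's `Prop39ii_monoAnalyticCompat` HOLDS for the induced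
poly-isomorphism `{⊗ φ_i | φ ∈ P}` of tensor packets, with campaign-S's `μ^log` on both sides.
[claim: Mochizuki2012, status: disputed] -/
theorem prop39ii_monoAnalyticCompat_tensorPacket (P : Set (∀ i, k i ≃ₐ[ℚ_[p]] k' i))
    (hP : ∀ φ ∈ P, ∀ i (x : k i), ‖φ i x‖ = ‖x‖) :
    Literature.IUT.LogThetaLattice.Prop39ii_monoAnalyticCompat
      ((fun φ => (factorAlgEquiv p k k' φ).toEquiv) '' P) (tensorLogVolume p k) (tensorLogVolume p k') := by
  rintro _ ⟨φ, hφP, rfl⟩ A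
  have hA : ((factorAlgEquiv p k k' φ).toEquiv : PacketAlgebra p k → PacketAlgebra p k') '' A =
      factorAlgEquiv p k k' φ '' A := rfl
  rw [hA, tensorLogVolume_image_factor p k k' φ (hP φ hφP) A]

end Volume

end Literature.IUT.LogVolume

end
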